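import Summits.BirchSwinnertonDyer.BirchSwinnertonDyer.Theorems.AlignedTransportAtTwoMainConjectureTransportAlignedAtTwoKilfordCopyCrossLevelSquarefreePairs
import HarnessLib

/-!
# Crux C1 `MainConjectureTransportAlignedAtTwo` (stmt-BirchSwinnertonDyer-22296), line `birth`, residual (R2) `stub_lamLawKilford`, UNEQUAL conductors:
# THE GENERAL «FACTOR-AND-ABSORB» REDUCTION — every conductor shape (additive and mixed exponents included): the cross-level same-kernel
# statement at the depleted level `N'` FOLLOWS from a same-kernel statement at a common level `L` between two GENERALISED OLD FORMS
# `Fᵢ = Σ_m R⁽ⁱ⁾_m·m·ι_m fᵢ` (abstract lattices) (width seat att-p3 g19; `--supports 22296`)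

THEOREMS ONLY (no `def`, no `sorry`, no named fact). Pure period bookkeeping generalising the cross-level series of att-p3 g18
(`…KilfordCopyCrossLevel{Tools, ·, Squarefree, SquarefreePairs, TwoSided, …}`, where the shapes `N₂ = q·N₁`, `N₂ = m·N₁` (`m` squarefree) and the
two-sided semistable shape were done). Nothing about Galois representations, alignment, multiplicities or the main conjecture is used or asserted.
BSD is not proved by this; C1 is not closed by this; the cross-level input of (R2) is REDUCED, not discharged.

MECHANISM. For an eigenform `f` of level `N` with integer coefficients and a set `S` of odd primes, att-p1 g9's exact depleted period formula reads
`{∞, r}_g = (∏_{ℓ∈S} D_ℓ·{∞,·}_f)(r)`, `D_ℓ = [1] − (a_ℓ/ℓ)[ℓ] + (𝟙_{ℓ∤N}/ℓ)[ℓ²]`; multiplying by `∏ℓ²` and using that an odd integer acts as `1` on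
`Λ/2Λ` (`…Tools.mul_act_prod_congr_mod_two`), `c·∏ℓ²·{∞,r}_g ≡ c·((∏_ℓ D̄_ℓ)·{∞,·}_f)(r) (mod 2Λ)` for ANY integer lifts `D̄_ℓ = [1] + b_ℓ[ℓ] + e_ℓ[ℓ²]`,
`b_ℓ ≡ a_ℓ(f)`, `e_ℓ ≡ 𝟙_{ℓ∤N} (mod 2)`. The mod-`2` classes of the Euler polynomial `1 + bV + eV²` are: good with `a_ℓ` even `(1+V)²`, good with
`a_ℓ` odd `1+V+V²`, multiplicative `1+V`, additive `1`. For TWO forms `f₁, f₂` choose the lifts so that they FACTOR EXACTLY over `ℤ` as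
`D̄⁽ⁱ⁾_ℓ = C_ℓ·R⁽ⁱ⁾_ℓ` with ONE common factor `C_ℓ = [1] + β_ℓ[ℓ] + ε_ℓ[ℓ²]` and side factors `R⁽ⁱ⁾_ℓ = [1] + ρ⁽ⁱ⁾_ℓ[ℓ] + σ⁽ⁱ⁾_ℓ[ℓ²]`
(exactness = the coefficients of `[ℓ³]`, `[ℓ⁴]` vanish: `βσ + ερ = 0`, `εσ = 0`; `factor_mul_factor`). Then
`∏_ℓ D̄⁽ⁱ⁾_ℓ = (∏_ℓ C_ℓ)·(∏_ℓ R⁽ⁱ⁾_ℓ)` (`prod_factor_mul_factor`), `(∏_ℓ R⁽ⁱ⁾_ℓ)·{∞,·}_{fᵢ} = {∞,·}_{Fᵢ}` for the generalised old form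
`Fᵢ ∈ S₂(Γ₀(L))` (`exists_factorForm`: it exists at every level `L` with `Nᵢ·∏ℓ^{deg R⁽ⁱ⁾_ℓ} ∣ L`, with integer `q`-expansion), and
`((∏C_ℓ)·{∞,·}_H)(r) = y(H)` for ONE cycle `y ∈ H₁(X₀(L);ℤ)` and every `H` of level `L` (`…Tools.exists_mem_periodHomology_apply_eq_act`). HENCE
(`sameKernel_depleted_of_sameKernel_factorForms`): same half-kernel at level `L` of `(c₁·y(F₁), c₂·y(F₂))` ⟹ same half-kernel of the `S`-depleted
functionals at `N'` — for EVERY conductor shape. The table of shapes (equal class: `C = P`, `R = 1`; good-even/mult: `C = R₁ = 1+V`; good-even/additive: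
`R₁ = 1+V²`; good-odd/additive: `R₁ = 1+V+V²`; mult/additive: `R₁ = 1+V`; always `L = lcm(N₁, N₂)`) is instantiated in the crux's currency in the sequel
`…KilfordCopyCrossLevelFactorConductor`.

* §1 `factor_mul_factor`, `prod_factor_mul_factor` (exact factorisation in the commutative monoid algebra `ℂ[ℕ^×]`).
* §2 `mul_act_prod_factor_mem` (integrality of `c·((∏R_ℓ)·ψ)(r)` under the sharp support condition `m ∣ ∏ℓ^{e_ℓ}`), `exists_smul_iota`,
  **`exists_factorForm`** (the generalised old form: integer coefficients + `{∞, s}_F = ((∏R_ℓ)·{∞,·}_f)(s)`), `factorForm_mul_apply_mem`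
  (`c·y(F) ∈ Λ` for `y ∈ H₁(X₀(L);ℤ)`, from the symbol identity alone).
* §3 **`sameKernel_depleted_of_sameKernel_factorForms`** (abstract lattices `Λᵢ ⊇ cᵢΛ_{fᵢ}`).

References: Greenberg–Vatsal 2000 §3 [GreenbergVatsal2000]; Emerton–Pollack–Weston 2006 §3 (3.4)–(3.5) [EmertonPollackWeston2006]; Cremona 1997 §2.4,
§2.10 [CremonaAlgorithms1997]; Diamond–Shurman §5.7 [DiamondShurman2005].
-/

noncomputable section

-- justification: the `Summit.BirchSwinnertonDyer.BirchSwinnertonDyer.…` path repeats a component (route-file convention)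
set_option linter.dupNamespace false
set_option autoImplicit false

open scoped MatrixGroups ModularForm Classical

open CongruenceSubgroup Complex
open Literature.NumberTheory.EllipticCurves Literature.NumberTheory.EllipticCurves.ModularForms
open Summit.BirchSwinnertonDyer.BirchSwinnertonDyer.Theorems.ThetaLayerLambdaCongruenceAtTwo
open Summit.BirchSwinnertonDyer.BirchSwinnertonDyer.Theorems.AlignedTransportAtTwoDepletedPeriodFormula
open Summit.BirchSwinnertonDyer.BirchSwinnertonDyer.Theorems.MazurTateCongruenceAtTwoR.DepletedLattice (modularSymbol_iota)
open Summit.BirchSwinnertonDyer.BirchSwinnertonDyer.Theorems.AlignedTransportAtTwoKilfordCopyCrossLevelTools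

namespace Summit.BirchSwinnertonDyer.BirchSwinnertonDyer.Theorems.AlignedTransportAtTwoKilfordCopyCrossLevelFactor

/-! ## §1 Exact factorisation of the integer Euler operators: `[1] + b[ℓ] + e[ℓ²] = C_ℓ · R_ℓ` -/

/-- **Exact product of two depletion-type factors.** In `ℂ[ℕ^×]`,
`([1] + β[ℓ] + ε[ℓ²])·([1] + ρ[ℓ] + σ[ℓ²]) = [1] + (β+ρ)[ℓ] + (ε+βρ+σ)[ℓ²]` as soon as the coefficients of `[ℓ³]` and `[ℓ⁴]` vanish
(`βσ + ερ = 0`, `εσ = 0`). [folklore] -/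
theorem factor_mul_factor (ℓ : ℕ) (β ε ρ σ : ℂ) (h₃ : β * σ + ε * ρ = 0) (h₄ : ε * σ = 0) :
    ((MonoidAlgebra.single 1 (1 : ℂ) + MonoidAlgebra.single ℓ β + MonoidAlgebra.single (ℓ ^ 2) ε) *
        (MonoidAlgebra.single 1 (1 : ℂ) + MonoidAlgebra.single ℓ ρ + MonoidAlgebra.single (ℓ ^ 2) σ) : MonoidAlgebra ℂ ℕ) =
      MonoidAlgebra.single 1 (1 : ℂ) + MonoidAlgebra.single ℓ (β + ρ) + MonoidAlgebra.single (ℓ ^ 2) (ε + β * ρ + σ) := by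
  have h₃' : (MonoidAlgebra.single (ℓ ^ 3) (β * σ) + MonoidAlgebra.single (ℓ ^ 3) (ε * ρ) : MonoidAlgebra ℂ ℕ) = 0 := by
    rw [← MonoidAlgebra.single_add, h₃, MonoidAlgebra.single_zero]
  have h₄' : (MonoidAlgebra.single (ℓ ^ 4) (ε * σ) : MonoidAlgebra ℂ ℕ) = 0 := by
    rw [h₄, MonoidAlgebra.single_zero]
  simp only [mul_add, add_mul, MonoidAlgebra.single_mul_single, one_mul, mul_one]
  rw [show ℓ * ℓ = ℓ ^ 2 by ring, show ℓ * ℓ ^ 2 = ℓ ^ 3 by ring, show ℓ ^ 2 * ℓ = ℓ ^ 3 by ring,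
    show ℓ ^ 2 * ℓ ^ 2 = ℓ ^ 4 by ring, MonoidAlgebra.single_add ℓ β ρ, MonoidAlgebra.single_add (ℓ ^ 2) (ε + β * ρ) σ,
    MonoidAlgebra.single_add (ℓ ^ 2) ε (β * ρ)]
  linear_combination h₃' + h₄'

/-- **Product over `S` of exact factorisations**: with `b_ℓ = β_ℓ + ρ_ℓ`, `e_ℓ = ε_ℓ + β_ℓρ_ℓ + σ_ℓ` and the exactness constraints at every `ℓ ∈ S`,
`∏_{ℓ∈S}([1] + b_ℓ[ℓ] + e_ℓ[ℓ²]) = (∏_{ℓ∈S} C_ℓ)·(∏_{ℓ∈S} R_ℓ)` (commutativity of `ℂ[ℕ^×]`). [folklore] -/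
theorem prod_factor_mul_factor (S : Finset ℕ) (β ε ρ σ : ℕ → ℤ)
    (h₃ : ∀ ℓ ∈ S, β ℓ * σ ℓ + ε ℓ * ρ ℓ = 0) (h₄ : ∀ ℓ ∈ S, ε ℓ * σ ℓ = 0) :
    (∏ ℓ ∈ S, (MonoidAlgebra.single 1 (1 : ℂ) + MonoidAlgebra.single ℓ (((β ℓ + ρ ℓ : ℤ)) : ℂ) +
        MonoidAlgebra.single (ℓ ^ 2) (((ε ℓ + β ℓ * ρ ℓ + σ ℓ : ℤ)) : ℂ)) : MonoidAlgebra ℂ ℕ) =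
      (∏ ℓ ∈ S, (MonoidAlgebra.single 1 (1 : ℂ) + MonoidAlgebra.single ℓ ((β ℓ : ℤ) : ℂ) +
          MonoidAlgebra.single (ℓ ^ 2) ((ε ℓ : ℤ) : ℂ))) *
        ∏ ℓ ∈ S, (MonoidAlgebra.single 1 (1 : ℂ) + MonoidAlgebra.single ℓ ((ρ ℓ : ℤ) : ℂ) +
          MonoidAlgebra.single (ℓ ^ 2) ((σ ℓ : ℤ) : ℂ)) := by
  rw [← Finset.prod_mul_distrib]
  refine Finset.prod_congr rfl fun ℓ hℓ ↦ ?_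
  rw [factor_mul_factor ℓ _ _ _ _ (by exact_mod_cast h₃ ℓ hℓ) (by exact_mod_cast h₄ ℓ hℓ)]
  push_cast
  rfl

/-! ## §2 The generalised old form `F = Σ_m R_m·m·ι_m f` at a common level `L`: integrality, existence, modular symbols -/

/-- **Integrality of the action of the side operator under the sharp support condition.** For integer data `(ρ_ℓ, σ_ℓ)` and exponents `e_ℓ`
with `ρ_ℓ = 0` unless `e_ℓ ≥ 1` and `σ_ℓ = 0` unless `e_ℓ ≥ 2`: if `c·ψ(m·r) ∈ Λ` for every `m ∣ ∏_{ℓ∈S} ℓ^{e_ℓ}`, then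
`c·((∏_{ℓ∈S}([1] + ρ_ℓ[ℓ] + σ_ℓ[ℓ²]))·ψ)(r) ∈ Λ`. [folklore] -/
theorem mul_act_prod_factor_mem (Λ : AddSubgroup ℂ) (ψ : ℚ → ℂ) (c : ℂ) (ρ σ : ℕ → ℤ) (e : ℕ → ℕ) (S : Finset ℕ)
    (hρ : ∀ ℓ ∈ S, e ℓ = 0 → ρ ℓ = 0) (hσ : ∀ ℓ ∈ S, e ℓ ≤ 1 → σ ℓ = 0) :
    ∀ (r : ℚ), (∀ m : ℕ, m ∣ ∏ ℓ ∈ S, ℓ ^ e ℓ → c * ψ ((m : ℚ) * r) ∈ Λ) →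
      c * ((∏ ℓ ∈ S, (MonoidAlgebra.single 1 (1 : ℂ) + MonoidAlgebra.single ℓ ((ρ ℓ : ℤ) : ℂ) +
          MonoidAlgebra.single (ℓ ^ 2) ((σ ℓ : ℤ) : ℂ)) : MonoidAlgebra ℂ ℕ).coeff.sum
        fun m a ↦ a * ψ ((m : ℚ) * r)) ∈ Λ := by
  classical
  induction S using Finset.induction_on with
  | empty =>
    intro r hΛ
    rw [Finset.prod_empty, MonoidAlgebra.one_def, act_single, one_mul]
    simpa only [Finset.prod_empty, Nat.cast_one] using hΛ 1 (by simp)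
  | insert ℓ S hℓS ih =>
    intro r hΛ
    have hρS : ∀ ℓ' ∈ S, e ℓ' = 0 → ρ ℓ' = 0 := fun ℓ' h ↦ hρ ℓ' (Finset.mem_insert_of_mem h)
    have hσS : ∀ ℓ' ∈ S, e ℓ' ≤ 1 → σ ℓ' = 0 := fun ℓ' h ↦ hσ ℓ' (Finset.mem_insert_of_mem h)
    -- `c·ψ(m·ℓʲ·r) ∈ Λ` for `m ∣ ∏_S` and `j ≤ e ℓ`
    have hsub : ∀ (j : ℕ), j ≤ e ℓ → ∀ m : ℕ, m ∣ ∏ ℓ' ∈ S, ℓ' ^ e ℓ' →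
        c * ψ ((m : ℚ) * (((ℓ ^ j : ℕ) : ℚ) * r)) ∈ Λ := by
      intro j hj m hm
      have h := hΛ (m * ℓ ^ j) (by
        rw [Finset.prod_insert hℓS]
        exact mul_comm (ℓ ^ e ℓ) _ ▸ mul_dvd_mul hm (pow_dvd_pow ℓ hj))
      simpa only [Nat.cast_mul, mul_assoc] using h
    have h0 := ih hρS hσS r (by simpa only [pow_zero, Nat.cast_one, one_mul] using hsub 0 (Nat.zero_le _))
    rw [Finset.prod_insert hℓS, act_factor_mul, mul_add, mul_add, mul_left_comm c ((ρ ℓ : ℤ) : ℂ),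
      mul_left_comm c ((σ ℓ : ℤ) : ℂ)]
    refine Λ.add_mem (Λ.add_mem h0 ?_) ?_
    · by_cases hρ0 : ρ ℓ = 0
      · rw [hρ0, Int.cast_zero, zero_mul]; exact Λ.zero_mem
      · have he : 1 ≤ e ℓ := Nat.one_le_iff_ne_zero.mpr fun h ↦ hρ0 (hρ ℓ (Finset.mem_insert_self ℓ S) h)
        have h1 := ih hρS hσS ((ℓ : ℚ) * r) (by simpa only [pow_one] using hsub 1 he)
        rw [← zsmul_eq_mul]; exact Λ.zsmul_mem h1 _
    · by_cases hσ0 : σ ℓ = 0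
      · rw [hσ0, Int.cast_zero, zero_mul]; exact Λ.zero_mem
      · have he : 2 ≤ e ℓ := by
          by_contra h
          exact hσ0 (hσ ℓ (Finset.mem_insert_self ℓ S) (by omega))
        have h2 := ih hρS hσS (((ℓ ^ 2 : ℕ) : ℚ) * r) (hsub 2 he)
        rw [← zsmul_eq_mul]; exact Λ.zsmul_mem h2 _

/-- One dilated summand `w·d·ι_d F₀` of the generalised old form (or `0` if `w = 0`): integer coefficients `w·d·a_{n/d}(F₀)` and symbols
`w·{∞, d s}_{F₀}` (`{∞, s}_{ι_d h} = d⁻¹{∞, d s}_h`); the level hypothesis `L₀·d ∣ L` is needed only when `w ≠ 0`.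
[cite: DiamondShurman2005, §5.7] [cite: CremonaAlgorithms1997, §2.4] -/
theorem exists_smul_iota {L₀ L : ℕ} [NeZero L₀] [NeZero L] (F₀ : CuspForm (Gamma0 L₀) 2) (hint : ∀ n, ∃ z : ℤ, cuspCoeff F₀ n = z)
    (d : ℕ) (hd : d ≠ 0) (w : ℤ) (h : w ≠ 0 → L₀ * d ∣ L) :
    ∃ G : CuspForm (Gamma0 L) 2, (∀ n, ∃ z : ℤ, cuspCoeff G n = z) ∧
      ∀ s : ℚ, modularSymbol G s = (w : ℂ) * modularSymbol F₀ ((d : ℚ) * s) := by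
  by_cases hw : w = 0
  · refine ⟨0, fun n ↦ ⟨0, ?_⟩, fun s ↦ ?_⟩
    · simp [cuspCoeff, UpperHalfPlane.qExpansion_zero]
    · have h0 := modularSymbol_const_smul (0 : ℂ) (0 : CuspForm (Gamma0 L) 2) s
      rw [zero_smul, zero_mul] at h0
      rw [h0, hw, Int.cast_zero, zero_mul]
  · haveI : NeZero d := ⟨hd⟩
    refine ⟨((w : ℂ) * (d : ℂ)) • iota L₀ L d 2 (h hw) F₀, fun n ↦ ?_, fun s ↦ ?_⟩
    · obtain ⟨z, hz⟩ := hint (n / d)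
      refine ⟨if d ∣ n then w * d * z else 0, ?_⟩
      have hc : cuspCoeff (((w : ℂ) * (d : ℂ)) • iota L₀ L d 2 (h hw) F₀) n =
          (w : ℂ) * (d : ℂ) * (if d ∣ n then cuspCoeff F₀ (n / d) else 0) := by
        simp only [cuspCoeff, qExpansion_coeff_smul, qExpansion_coeff_iota]
      rw [hc, hz]
      split_ifs <;> push_cast <;> ring
    · have hd0 : (d : ℂ) ≠ 0 := by exact_mod_cast hd
      rw [modularSymbol_const_smul, modularSymbol_iota, mul_assoc, ← mul_assoc (d : ℂ), mul_inv_cancel₀ hd0, one_mul]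

/-- **The generalised old form exists.** `f ∈ S₂(Γ₀(N))` with integer coefficients; integer data `(ρ_ℓ, σ_ℓ)_{ℓ∈S}` with exponents `e_ℓ`
(`ρ_ℓ = 0` unless `e_ℓ ≥ 1`, `σ_ℓ = 0` unless `e_ℓ ≥ 2`, all `ℓ ≠ 0`); any level `L` with `N·∏_{ℓ∈S}ℓ^{e_ℓ} ∣ L`. Then there is
`F ∈ S₂(Γ₀(L))` with INTEGER `q`-expansion and `{∞, s}_F = ((∏_{ℓ∈S}([1] + ρ_ℓ[ℓ] + σ_ℓ[ℓ²]))·{∞,·}_f)(s)` for every `s` — namely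
`F = Σ_m R_m·m·ι_m f` built prime by prime (`F ↦ F + ρ_ℓ ℓ·ι_ℓ F + σ_ℓ ℓ²·ι_{ℓ²} F`). Mod `2` and for `0/1` data this is `f | ∏_ℓ R_ℓ(V_ℓ)`, the
partial depletion of `f` by the side factors. [cite: DiamondShurman2005, §5.7] [cite: CremonaAlgorithms1997, §2.4] -/
theorem exists_factorForm {N : ℕ} [NeZero N] (f : CuspForm (Gamma0 N) 2) (A : ℕ → ℤ) (hA : ∀ n, cuspCoeff f n = A n)
    (ρ σ : ℕ → ℤ) (e : ℕ → ℕ) (S : Finset ℕ) :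
    (∀ ℓ ∈ S, ℓ ≠ 0) → (∀ ℓ ∈ S, e ℓ = 0 → ρ ℓ = 0) → (∀ ℓ ∈ S, e ℓ ≤ 1 → σ ℓ = 0) →
    ∀ (L : ℕ) [NeZero L], N * ∏ ℓ ∈ S, ℓ ^ e ℓ ∣ L →
    ∃ F : CuspForm (Gamma0 L) 2, (∀ n, ∃ z : ℤ, cuspCoeff F n = z) ∧
      ∀ s : ℚ, modularSymbol F s =
        ((∏ ℓ ∈ S, (MonoidAlgebra.single 1 (1 : ℂ) + MonoidAlgebra.single ℓ ((ρ ℓ : ℤ) : ℂ) +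
          MonoidAlgebra.single (ℓ ^ 2) ((σ ℓ : ℤ) : ℂ)) : MonoidAlgebra ℂ ℕ).coeff.sum fun m a ↦ a * modularSymbol f ((m : ℚ) * s)) := by
  classical
  induction S using Finset.induction_on with
  | empty =>
    intro _ _ _ L _ hL
    rw [Finset.prod_empty, mul_one] at hL
    refine ⟨toLevel0 hL 2 f, fun n ↦ ⟨A n, ?_⟩, fun s ↦ ?_⟩
    · rw [← hA n]; rfl
    · rw [Finset.prod_empty, MonoidAlgebra.one_def, act_single, Nat.cast_one, one_mul, one_mul, modularSymbol_toLevel0]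
  | insert ℓ S hℓS ih =>
    intro hS0 hρ hσ L _ hL
    set L₀ : ℕ := N * ∏ ℓ' ∈ S, ℓ' ^ e ℓ' with hL₀
    haveI : NeZero L₀ := ⟨mul_ne_zero (NeZero.ne N)
      (Finset.prod_ne_zero_iff.mpr fun ℓ' h ↦ pow_ne_zero _ (hS0 ℓ' (Finset.mem_insert_of_mem h)))⟩
    obtain ⟨F₀, hF₀int, hF₀sym⟩ := ih (fun ℓ' h ↦ hS0 ℓ' (Finset.mem_insert_of_mem h))
      (fun ℓ' h ↦ hρ ℓ' (Finset.mem_insert_of_mem h)) (fun ℓ' h ↦ hσ ℓ' (Finset.mem_insert_of_mem h)) L₀ dvd_rfl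
    have hL₀L : L₀ * ℓ ^ e ℓ ∣ L := by
      rw [Finset.prod_insert hℓS] at hL
      rw [hL₀, show N * (∏ ℓ' ∈ S, ℓ' ^ e ℓ') * ℓ ^ e ℓ = N * (ℓ ^ e ℓ * ∏ ℓ' ∈ S, ℓ' ^ e ℓ') by ring]
      exact hL
    have hℓ0 : ℓ ≠ 0 := hS0 ℓ (Finset.mem_insert_self ℓ S)
    have h₀ : L₀ ∣ L := (Dvd.intro _ rfl).trans hL₀L
    -- the two dilated summands
    obtain ⟨G₁, hG₁int, hG₁sym⟩ := exists_smul_iota (L := L) F₀ hF₀int ℓ hℓ0 (ρ ℓ) (fun hw ↦ by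
      have he : 1 ≤ e ℓ := Nat.one_le_iff_ne_zero.mpr fun h ↦ hw (hρ ℓ (Finset.mem_insert_self ℓ S) h)
      exact (mul_dvd_mul_left L₀ (by simpa only [pow_one] using pow_dvd_pow ℓ he)).trans hL₀L)
    obtain ⟨G₂, hG₂int, hG₂sym⟩ := exists_smul_iota (L := L) F₀ hF₀int (ℓ ^ 2) (pow_ne_zero 2 hℓ0) (σ ℓ) (fun hw ↦ by
      have he : 2 ≤ e ℓ := by
        by_contra h
        exact hw (hσ ℓ (Finset.mem_insert_self ℓ S) (by omega))
      exact (mul_dvd_mul_left L₀ (pow_dvd_pow ℓ he)).trans hL₀L)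
    refine ⟨toLevel0 h₀ 2 F₀ + G₁ + G₂, fun n ↦ ?_, fun s ↦ ?_⟩
    · obtain ⟨z₀, hz₀⟩ := hF₀int n
      obtain ⟨z₁, hz₁⟩ := hG₁int n
      obtain ⟨z₂, hz₂⟩ := hG₂int n
      refine ⟨z₀ + z₁ + z₂, ?_⟩
      have h0' : cuspCoeff (toLevel0 h₀ 2 F₀) n = cuspCoeff F₀ n := rfl
      rw [cuspCoeff, qExpansion_coeff_add_level0, qExpansion_coeff_add_level0, ← cuspCoeff, ← cuspCoeff, ← cuspCoeff, h0', hz₀, hz₁, hz₂]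
      push_cast; ring
    · rw [modularSymbol_add, modularSymbol_add, modularSymbol_toLevel0, hG₁sym, hG₂sym, hF₀sym, hF₀sym, hF₀sym,
        Finset.prod_insert hℓS, act_factor_mul]

/-- **`c·y(F) ∈ Λ` for every cycle `y ∈ H₁(X₀(L);ℤ)`**, for ANY form `F` of level `L` whose symbols are `((∏R_ℓ)·{∞,·}_f)(s)` (data as in
`exists_factorForm`, `N·∏ℓ^{e_ℓ} ∣ L`, `Λ ⊇ c·Λ_f`): the dilated cusps `m·γ∞` (`m ∣ ∏ℓ^{e_ℓ}`) are `Γ₀(N)`-translates of `∞`. This is the `hg`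
hypothesis of the T1⁺ carrier's `jacobiMapForm L F`. [cite: CremonaAlgorithms1997, §2.4 and §2.10] -/
theorem factorForm_mul_apply_mem {N L : ℕ} [NeZero N] [NeZero L] (f : CuspForm (Gamma0 N) 2)
    (ρ σ : ℕ → ℤ) (e : ℕ → ℕ) (S : Finset ℕ) (hS0 : ∀ ℓ ∈ S, ℓ ≠ 0)
    (hρ : ∀ ℓ ∈ S, e ℓ = 0 → ρ ℓ = 0) (hσ : ∀ ℓ ∈ S, e ℓ ≤ 1 → σ ℓ = 0) (hL : N * ∏ ℓ ∈ S, ℓ ^ e ℓ ∣ L)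
    (F : CuspForm (Gamma0 L) 2)
    (hF : ∀ s : ℚ, modularSymbol F s =
      ((∏ ℓ ∈ S, (MonoidAlgebra.single 1 (1 : ℂ) + MonoidAlgebra.single ℓ ((ρ ℓ : ℤ) : ℂ) +
        MonoidAlgebra.single (ℓ ^ 2) ((σ ℓ : ℤ) : ℂ)) : MonoidAlgebra ℂ ℕ).coeff.sum fun m a ↦ a * modularSymbol f ((m : ℚ) * s)))
    (Λ : AddSubgroup ℂ) (c : ℂ) (hc : ∀ z ∈ periodLattice f, c * z ∈ Λ) :
    ∀ y ∈ periodHomology L, c * y F ∈ Λ := by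
  intro y hy
  have hy' : y ∈ (periodHomology L : Set (Module.Dual ℂ (CuspForm (Gamma0 L) 2))) := hy
  rw [coe_periodHomology_eq_range] at hy'
  obtain ⟨γ, rfl⟩ := hy'
  rw [periodFunctional_apply]
  by_cases hγ : (γ : SL(2, ℤ)) 1 0 = 0
  · rw [cuspSymbol, if_pos hγ, mul_zero]; exact Λ.zero_mem
  set r : ℚ := (((γ : SL(2, ℤ)) 0 0 : ℚ) / ((γ : SL(2, ℤ)) 1 0 : ℚ)) with hr
  rw [cuspSymbol, if_neg hγ, hF]
  have hM0 : (∏ ℓ ∈ S, ℓ ^ e ℓ) ≠ 0 := Finset.prod_ne_zero_iff.mpr fun ℓ hℓ ↦ pow_ne_zero _ (hS0 ℓ hℓ)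
  refine mul_act_prod_factor_mem Λ (modularSymbol f) c ρ σ e S hρ hσ r fun m hm ↦ ?_
  obtain ⟨δ, hδ, hδr⟩ := exists_gamma0_dilate_cusp (ne_zero_of_dvd_ne_zero hM0 hm) ((mul_dvd_mul_left N hm).trans hL) γ hγ
  have h : cuspSymbol f δ = modularSymbol f ((m : ℚ) * r) := by rw [cuspSymbol, if_neg hδ, hδr]
  rw [← h]
  exact hc _ (cuspSymbol_mem_periodLattice f δ)

/-! ## §3 THE GENERAL REDUCTION: same half-kernel at the common level `L` for `(F₁, F₂)` ⟹ same half-kernel of the `S`-depleted functionals -/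

/-- **Cross-level same-kernel from a common level, EVERY SHAPE (abstract lattices).** `fᵢ ∈ S₂(Γ₀(Nᵢ))` Hecke eigenforms with integer
coefficients `Aᵢ`; `S` a set of odd primes; integer data: a COMMON factor `C_ℓ = [1] + β_ℓ[ℓ] + ε_ℓ[ℓ²]` and side factors
`R⁽ⁱ⁾_ℓ = [1] + ρ⁽ⁱ⁾_ℓ[ℓ] + σ⁽ⁱ⁾_ℓ[ℓ²]` (`i = 1, 2`) such that the products `C_ℓ·R⁽ⁱ⁾_ℓ` are EXACT lifts of the mod-`2` Euler data of `fᵢ`: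
`β_ℓσ⁽ⁱ⁾_ℓ + ε_ℓρ⁽ⁱ⁾_ℓ = 0`, `ε_ℓσ⁽ⁱ⁾_ℓ = 0`, `β_ℓ + ρ⁽ⁱ⁾_ℓ ≡ a_ℓ(fᵢ)`, `ε_ℓ + β_ℓρ⁽ⁱ⁾_ℓ + σ⁽ⁱ⁾_ℓ ≡ 𝟙_{ℓ∤Nᵢ} (mod 2)`; `gᵢ` the `S`-depleted forms at a
level `N'` with `Nᵢ∏ℓ² ∣ N'` and `L∏ℓ² ∣ N'`; `Fᵢ ∈ S₂(Γ₀(L))` ANY forms with `{∞, s}_{Fᵢ} = ((∏_ℓ R⁽ⁱ⁾_ℓ)·{∞,·}_{fᵢ})(s)` (they exist: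
`exists_factorForm`); `Λᵢ ⊇ cᵢΛ_{fᵢ}`. IF the half-kernels of `y ↦ c₁·y(F₁)` and `y ↦ c₂·y(F₂)` on `H₁(X₀(L);ℤ)` agree, THEN so do the
half-kernels of the depleted functionals `x ↦ cᵢ·∏ℓ²·x(gᵢ)` on `H₁(X₀(N');ℤ)`: both are `cᵢ·y(Fᵢ)` modulo `2Λᵢ` for ONE cycle
`y ∈ H₁(X₀(L);ℤ)` — `…Tools.mul_act_prod_congr_mod_two` with the lifts `(β + ρ⁽ⁱ⁾, ε + βρ⁽ⁱ⁾ + σ⁽ⁱ⁾)`, `prod_factor_mul_factor`, `act_mul`, the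
symbol identity, `…Tools.exists_mem_periodHomology_apply_eq_act`. The shapes of att-p3 g18 (`q·N₁`, squarefree `m·N₁`, two-sided semistable)
are the cases `C_ℓ ∈ {P_ℓ, 1+V}`, `R ∈ {1, 1+V}`; additive and mixed exponents are the cases `R ∈ {1+V², 1+V+V², 1+V}` with `C = 1`. No alignment,
Galois or multiplicity input. [cite: GreenbergVatsal2000, §3] [cite: EmertonPollackWeston2006, §3 (3.4)–(3.5)] [cite: CremonaAlgorithms1997, §2.4] -/
theorem sameKernel_depleted_of_sameKernel_factorForms
    {N₁ N₂ L : ℕ} [NeZero N₁] [NeZero N₂] [NeZero L]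
    (f₁ : CuspForm (Gamma0 N₁) 2) (f₂ : CuspForm (Gamma0 N₂) 2)
    (A₁ A₂ : ℕ → ℤ) (hA₁ : ∀ n, cuspCoeff f₁ n = A₁ n) (hA₂ : ∀ n, cuspCoeff f₂ n = A₂ n)
    (hT₁ : ∀ (p : ℕ) (hp : p.Prime), (haveI : NeZero p := ⟨hp.ne_zero⟩; heckeT (Gamma0 N₁) 2 p f₁) = cuspCoeff f₁ p • f₁)
    (hT₂ : ∀ (p : ℕ) (hp : p.Prime), (haveI : NeZero p := ⟨hp.ne_zero⟩; heckeT (Gamma0 N₂) 2 p f₂) = cuspCoeff f₂ p • f₂)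
    (S : Finset ℕ) (hS : ∀ ℓ ∈ S, ℓ.Prime) (hSodd : ∀ ℓ ∈ S, Odd ℓ)
    (β ε ρ₁ σ₁ ρ₂ σ₂ : ℕ → ℤ)
    (hx₁ : ∀ ℓ ∈ S, β ℓ * σ₁ ℓ + ε ℓ * ρ₁ ℓ = 0) (hx₁' : ∀ ℓ ∈ S, ε ℓ * σ₁ ℓ = 0)
    (hx₂ : ∀ ℓ ∈ S, β ℓ * σ₂ ℓ + ε ℓ * ρ₂ ℓ = 0) (hx₂' : ∀ ℓ ∈ S, ε ℓ * σ₂ ℓ = 0)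
    (hb₁ : ∀ ℓ ∈ S, (2 : ℤ) ∣ -A₁ ℓ - (β ℓ + ρ₁ ℓ))
    (he₁ : ∀ ℓ ∈ S, (2 : ℤ) ∣ (if ℓ ∣ N₁ then 0 else 1) - (ε ℓ + β ℓ * ρ₁ ℓ + σ₁ ℓ))
    (hb₂ : ∀ ℓ ∈ S, (2 : ℤ) ∣ -A₂ ℓ - (β ℓ + ρ₂ ℓ))
    (he₂ : ∀ ℓ ∈ S, (2 : ℤ) ∣ (if ℓ ∣ N₂ then 0 else 1) - (ε ℓ + β ℓ * ρ₂ ℓ + σ₂ ℓ))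
    (N' : ℕ) [NeZero N'] (hN₁' : N₁ * ∏ ℓ ∈ S, ℓ ^ 2 ∣ N') (hN₂' : N₂ * ∏ ℓ ∈ S, ℓ ^ 2 ∣ N') (hL' : L * ∏ ℓ ∈ S, ℓ ^ 2 ∣ N')
    (g₁ g₂ : CuspForm (Gamma0 N') 2)
    (hg₁ : ∀ n, cuspCoeff g₁ n = if ∃ ℓ ∈ S, ℓ ∣ n then 0 else cuspCoeff f₁ n)
    (hg₂ : ∀ n, cuspCoeff g₂ n = if ∃ ℓ ∈ S, ℓ ∣ n then 0 else cuspCoeff f₂ n)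
    (F₁ F₂ : CuspForm (Gamma0 L) 2)
    (hF₁ : ∀ s : ℚ, modularSymbol F₁ s =
      ((∏ ℓ ∈ S, (MonoidAlgebra.single 1 (1 : ℂ) + MonoidAlgebra.single ℓ ((ρ₁ ℓ : ℤ) : ℂ) +
        MonoidAlgebra.single (ℓ ^ 2) ((σ₁ ℓ : ℤ) : ℂ)) : MonoidAlgebra ℂ ℕ).coeff.sum fun m a ↦ a * modularSymbol f₁ ((m : ℚ) * s)))
    (hF₂ : ∀ s : ℚ, modularSymbol F₂ s =
      ((∏ ℓ ∈ S, (MonoidAlgebra.single 1 (1 : ℂ) + MonoidAlgebra.single ℓ ((ρ₂ ℓ : ℤ) : ℂ) +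
        MonoidAlgebra.single (ℓ ^ 2) ((σ₂ ℓ : ℤ) : ℂ)) : MonoidAlgebra ℂ ℕ).coeff.sum fun m a ↦ a * modularSymbol f₂ ((m : ℚ) * s)))
    (Λ₁ Λ₂ : AddSubgroup ℂ) (c₁ c₂ : ℂ)
    (hc₁ : ∀ z ∈ periodLattice f₁, c₁ * z ∈ Λ₁) (hc₂ : ∀ z ∈ periodLattice f₂, c₂ * z ∈ Λ₂)
    (hker : ∀ y ∈ periodHomology L, c₁ * y F₁ / 2 ∈ Λ₁ ↔ c₂ * y F₂ / 2 ∈ Λ₂) :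
    ∀ x ∈ periodHomology N',
      c₁ * (((∏ ℓ ∈ S, ℓ ^ 2 : ℕ) : ℂ) * x g₁) / 2 ∈ Λ₁ ↔ c₂ * (((∏ ℓ ∈ S, ℓ ^ 2 : ℕ) : ℂ) * x g₂) / 2 ∈ Λ₂ := by
  classical
  intro x hx
  have hM0 : (∏ ℓ ∈ S, ℓ ^ 2) ≠ 0 := Finset.prod_ne_zero_iff.mpr fun ℓ hℓ ↦ pow_ne_zero 2 (hS ℓ hℓ).ne_zero
  have hℓ0 : ∀ ℓ ∈ S, (ℓ : ℂ) ≠ 0 := fun ℓ hℓ ↦ by exact_mod_cast (hS ℓ hℓ).ne_zero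
  -- `x` is the period functional of one `γ ∈ Γ₀(N')`
  have hx' : x ∈ (periodHomology N' : Set (Module.Dual ℂ (CuspForm (Gamma0 N') 2))) := hx
  rw [coe_periodHomology_eq_range] at hx'
  obtain ⟨γ, rfl⟩ := hx'
  simp only [periodFunctional_apply]
  by_cases hγ : (γ : SL(2, ℤ)) 1 0 = 0
  · simp only [cuspSymbol, if_pos hγ, mul_zero, zero_div, Λ₁.zero_mem, Λ₂.zero_mem]
  set r : ℚ := (((γ : SL(2, ℤ)) 0 0 : ℚ) / ((γ : SL(2, ℤ)) 1 0 : ℚ)) with hr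
  have hcusp : ∀ g : CuspForm (Gamma0 N') 2, cuspSymbol g γ = modularSymbol g r := fun g ↦ by
    rw [cuspSymbol, if_neg hγ]
  rw [hcusp, hcusp]
  -- ONE side at a time: the depleted functional of `f` is `c·((∏C)·{∞,·}_F)(r)` modulo `2Λ`
  have side : ∀ {N : ℕ} [NeZero N] (f : CuspForm (Gamma0 N) 2) (A : ℕ → ℤ) (_ : ∀ n, cuspCoeff f n = A n)
      (_ : ∀ (p : ℕ) (hp : p.Prime), (haveI : NeZero p := ⟨hp.ne_zero⟩; heckeT (Gamma0 N) 2 p f) = cuspCoeff f p • f)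
      (ρ σ : ℕ → ℤ) (_ : ∀ ℓ ∈ S, β ℓ * σ ℓ + ε ℓ * ρ ℓ = 0) (_ : ∀ ℓ ∈ S, ε ℓ * σ ℓ = 0)
      (_ : ∀ ℓ ∈ S, (2 : ℤ) ∣ -A ℓ - (β ℓ + ρ ℓ))
      (_ : ∀ ℓ ∈ S, (2 : ℤ) ∣ (if ℓ ∣ N then 0 else 1) - (ε ℓ + β ℓ * ρ ℓ + σ ℓ))
      (_ : N * ∏ ℓ ∈ S, ℓ ^ 2 ∣ N') (g : CuspForm (Gamma0 N') 2)
      (_ : ∀ n, cuspCoeff g n = if ∃ ℓ ∈ S, ℓ ∣ n then 0 else cuspCoeff f n) (F : CuspForm (Gamma0 L) 2)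
      (_ : ∀ s : ℚ, modularSymbol F s =
        ((∏ ℓ ∈ S, (MonoidAlgebra.single 1 (1 : ℂ) + MonoidAlgebra.single ℓ ((ρ ℓ : ℤ) : ℂ) +
          MonoidAlgebra.single (ℓ ^ 2) ((σ ℓ : ℤ) : ℂ)) : MonoidAlgebra ℂ ℕ).coeff.sum fun m a ↦ a * modularSymbol f ((m : ℚ) * s)))
      (Λ : AddSubgroup ℂ) (c : ℂ) (_ : ∀ z ∈ periodLattice f, c * z ∈ Λ),
      ∃ z ∈ Λ, c * (((∏ ℓ ∈ S, ℓ ^ 2 : ℕ) : ℂ) * modularSymbol g r) =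
        c * ((∏ ℓ ∈ S, (MonoidAlgebra.single 1 (1 : ℂ) + MonoidAlgebra.single ℓ ((β ℓ : ℤ) : ℂ) +
          MonoidAlgebra.single (ℓ ^ 2) ((ε ℓ : ℤ) : ℂ)) : MonoidAlgebra ℂ ℕ).coeff.sum fun m a ↦ a * modularSymbol F ((m : ℚ) * r)) + 2 * z := by
    intro N _ f A hA hT ρ σ hx hx' hb he hN g hg F hF Λ c hc
    -- integrality at the dilated cusps
    have hΛ : ∀ m : ℕ, m ∣ ∏ ℓ ∈ S, ℓ ^ 2 → c * modularSymbol f ((m : ℚ) * r) ∈ Λ := by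
      intro m hm
      obtain ⟨δ, hδ, hδr⟩ := exists_gamma0_dilate_cusp (ne_zero_of_dvd_ne_zero hM0 hm) ((mul_dvd_mul_left _ hm).trans hN) γ hγ
      have h : cuspSymbol f δ = modularSymbol f ((m : ℚ) * r) := by rw [cuspSymbol, if_neg hδ, hδr]
      rw [← h]
      exact hc _ (cuspSymbol_mem_periodLattice f δ)
    -- the exact depleted period formula, then clear denominators modulo `2Λ` with the lifts `(β + ρ, ε + βρ + σ)`
    have hdep := modularSymbol_depleted_eq_act_of_dvd f hT S hS N' hN g hg r
    have hu : ∀ ℓ ∈ S, (ℓ : ℂ) * (-(cuspCoeff f ℓ) * (ℓ : ℂ)⁻¹) = ((-A ℓ : ℤ) : ℂ) := fun ℓ hℓ ↦ by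
      rw [hA, mul_comm, mul_assoc, inv_mul_cancel₀ (hℓ0 ℓ hℓ), mul_one, Int.cast_neg]
    have hv : ∀ ℓ ∈ S, (ℓ : ℂ) * (if ℓ ∣ N then 0 else (ℓ : ℂ)⁻¹) = ((if ℓ ∣ N then 0 else 1 : ℤ) : ℂ) := fun ℓ hℓ ↦ by
      split_ifs <;> simp [mul_inv_cancel₀ (hℓ0 ℓ hℓ)]
    obtain ⟨z, hz, h⟩ := mul_act_prod_congr_mod_two Λ (modularSymbol f) c
      (fun ℓ ↦ -(cuspCoeff f ℓ) * (ℓ : ℂ)⁻¹) (fun ℓ ↦ if ℓ ∣ N then 0 else (ℓ : ℂ)⁻¹)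
      (fun ℓ ↦ -A ℓ) (fun ℓ ↦ if ℓ ∣ N then 0 else 1) (fun ℓ ↦ β ℓ + ρ ℓ) (fun ℓ ↦ ε ℓ + β ℓ * ρ ℓ + σ ℓ)
      S hSodd hu hv hb he r hΛ
    refine ⟨z, hz, ?_⟩
    rw [hdep, ← mul_assoc, h, prod_factor_mul_factor S β ε ρ σ hx hx', act_mul]
    simp only [← hF]
  obtain ⟨z₁, hz₁, E1⟩ := side f₁ A₁ hA₁ hT₁ ρ₁ σ₁ hx₁ hx₁' hb₁ he₁ hN₁' g₁ hg₁ F₁ hF₁ Λ₁ c₁ hc₁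
  obtain ⟨z₂, hz₂, E2⟩ := side f₂ A₂ hA₂ hT₂ ρ₂ σ₂ hx₂ hx₂' hb₂ he₂ hN₂' g₂ hg₂ F₂ hF₂ Λ₂ c₂ hc₂
  -- ONE cycle `y ∈ H₁(X₀(L);ℤ)` computing the common operator `∏C_ℓ` on every form of level `L`
  obtain ⟨y, hy, hyH⟩ := exists_mem_periodHomology_apply_eq_act L β ε S r (fun m hm ↦
    exists_gamma0_dilate_cusp (ne_zero_of_dvd_ne_zero hM0 hm) ((mul_dvd_mul_left _ hm).trans hL') γ hγ)
  rw [← hyH F₁] at E1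
  rw [← hyH F₂] at E2
  rw [div_two_mem_iff_of_eq_add Λ₁ hz₁ E1, div_two_mem_iff_of_eq_add Λ₂ hz₂ E2]
  exact hker y hy

end Summit.BirchSwinnertonDyer.BirchSwinnertonDyer.Theorems.AlignedTransportAtTwoKilfordCopyCrossLevelFactor

end
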